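import Mathlib
import HarnessLib
import Summits.HubbardSuperconductivity.HubbardSuperconductivity.Theorems.KLProgrammeC4aCausticAngleLayer

/-!
# Route `KLProgramme` — crux C4a, S3 brick (B4) «(B4)-UMK1», the ϑ-LAYER AT A WEAKLY TRANSVERSAL PAIR OR A DOUBLE ZERO of the caustic offset (product form
# `|δ₀(ϑ)| ≥ b|ϑ − c₁||ϑ − c₂|`): with a ONE-SIDED pre-caustic law outside `[c₁,c₂]` and a LOG-FREE square-root law inside, the umklapp first-order jet
# integrates to `(8A + 4P)/√b + B·(length)` — UNIFORM in the gap `c₂ − c₁`, hence θ-uniform through an antipodal-umklapp touch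

Cell `gate-hubbard-kl`, seat hubbard-kl-k3c3-p3 (g28; row «implicit-function / monotonicity route for μ(n)»).  Located brick for the (C)-closer lane hubbard-kl-c4a-1
(stub (C) `stub_twoLeg_curvature` of `KLRegimeEngineV17F2`, stmt-HubbardSuperconductivity-20437), memo HOME/hubbard-kl-k3c3-p3/U1-CAUSTIC-SUP.md §3–§4 (N3)/(N6).
`…C4aCausticAngleLayer.intervalIntegral_caustic_window_le` needs `|δ₀(ϑ)| ≳ |ϑ − c|` (a transversal zero).  At the antipodal-umklapp configurations
(`k + 3q′ ∈ 2πℤ²∖0`, memo §3) the offset has a PRE-SIDE DOUBLE ZERO, `δ₀ ≈ b(ϑ − c)²`, and for nearby base angles a pair of weakly transversal zeros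
`δ₀ ≈ b(ϑ − c₁)(ϑ − c₂)` with `c₂ − c₁ → 0`; the two-sided level layer `|δ₀|^{−1/2}·log²` is then not integrable uniformly.  What IS uniformly integrable (this file,
pure real analysis, no integrability hypothesis on `F`):
* §1 majorants: `pre_majorant_le` (`|m| ≥ b x²` ⟹ `lo·max(|m|,lo)^{−3/2} ≤ 8lo/(√b·x + √lo)³`), `post_majorant_le` (`|m| ≥ b·h·x` ⟹ `|m|^{−1/2} ≤ (bh)^{−1/2}x^{−1/2}`),
  and their integrals `intervalIntegral_pre_majorant_le` (`≤ 4/√b`, any `lo > 0`), `intervalIntegral_post_majorant` (`= 2/√b` on a half gap of any length `h > 0`);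
* §2 **`intervalIntegral_caustic_pair_le`**: `c₁ ≤ c₂`, window `[c₁ − δ, c₂ + δ]`, `F ≥ 0`, an offset `m` with `b|ϑ − c₁||ϑ − c₂| ≤ |m ϑ|`; OUTSIDE `[c₁,c₂]` the one-sided
  pre-caustic law `F ≤ A·lo·max(|m|,lo)^{−1}·max(|m|,lo)^{−1/2} + B`, INSIDE `(c₁,c₂)` the log-free post-caustic law `F ≤ P·|m|^{−1/2} + B` ⟹
  `∫_{c₁−δ}^{c₂+δ} F ≤ (8A + 4P)/√b + B·(2δ + (c₂ − c₁))` — no dependence on `lo` nor on the gap: the `n`-free, θ-uniform ϑ-layer the (U1) assembly needs at and near a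
  degenerate caustic crossing (memo §4: the pre-side law (N2) and a log-free post-side law (N5) are the upstream inputs; `b` comes from the positive-definite Hessian (N3)).
References: Salmhofer 1999 §4.5.3 [cite: Salmhofer1999]; FST II CPAM 51 (1998) §3 [cite: FeldmanSalmhoferTrubowitz1998].
-/

noncomputable section

namespace Summit.HubbardSuperconductivity.HubbardSuperconductivity.Theorems.C4a

set_option linter.dupNamespace false -- summit = problem name (single-conjunct summit), D-0017

open Real Set MeasureTheory intervalIntegral

/-! ## §1 Majorants and their integrals -/

/-- **Pre-side majorant**: `0 < lo`, `0 < b`, `b·x² ≤ |m|` ⟹ `lo·(max |m| lo)⁻¹·(√(max |m| lo))⁻¹ ≤ 8·lo/(√b·x + √lo)³` (for `x ≥ 0`). -/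
theorem pre_majorant_le {lo b x m : ℝ} (hlo : 0 < lo) (hb : 0 < b) (hx : 0 ≤ x) (hm : b * x ^ 2 ≤ |m|) :
    lo * ((max |m| lo)⁻¹ * (Real.sqrt (max |m| lo))⁻¹) ≤ 8 * lo / (Real.sqrt b * x + Real.sqrt lo) ^ 3 := by
  set M := max |m| lo with hM
  have hMpos : 0 < M := lt_max_of_lt_right hlo
  have hsM : 0 < Real.sqrt M := Real.sqrt_pos.2 hMpos
  -- `2√M ≥ √b x + √lo`
  have h1 : Real.sqrt b * x ≤ Real.sqrt M := by
    have : Real.sqrt (b * x ^ 2) = Real.sqrt b * x := by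
      rw [Real.sqrt_mul hb.le, Real.sqrt_sq hx]
    rw [← this]
    exact Real.sqrt_le_sqrt (hm.trans (le_max_left _ _))
  have h2 : Real.sqrt lo ≤ Real.sqrt M := Real.sqrt_le_sqrt (le_max_right _ _)
  have hq : Real.sqrt b * x + Real.sqrt lo ≤ 2 * Real.sqrt M := by linarith
  have hqpos : 0 < Real.sqrt b * x + Real.sqrt lo := by
    have := Real.sqrt_pos.2 hlo; have : 0 ≤ Real.sqrt b * x := by positivity
    linarith
  -- `M⁻¹ (√M)⁻¹ = (√M)⁻³`
  have hMsq : M = Real.sqrt M ^ 2 := (Real.sq_sqrt hMpos.le).symm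
  have hlhs : lo * (M⁻¹ * (Real.sqrt M)⁻¹) = lo / Real.sqrt M ^ 3 := by
    rw [hMsq, Real.sqrt_sq hsM.le]; field_simp
  rw [hlhs, div_le_div_iff₀ (by positivity) (by positivity)]
  -- `lo (√b x + √lo)³ ≤ 8 lo (√M)³`
  have h3 : (Real.sqrt b * x + Real.sqrt lo) ^ 3 ≤ (2 * Real.sqrt M) ^ 3 := by
    exact pow_le_pow_left₀ hqpos.le hq 3
  nlinarith [h3, hlo]

/-- **Post-side majorant**: `0 < b`, `0 < h`, `0 < x`, `b·h·x ≤ |m|` ⟹ `(√|m|)⁻¹ ≤ (√(b·h))⁻¹ · x^{−1/2}`. -/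
theorem post_majorant_le {b h x m : ℝ} (hb : 0 < b) (hh : 0 < h) (hx : 0 < x) (hm : b * h * x ≤ |m|) :
    (Real.sqrt |m|)⁻¹ ≤ (Real.sqrt (b * h))⁻¹ * x ^ (-(1 / 2) : ℝ) := by
  have hbhx : 0 < b * h * x := by positivity
  have h1 : Real.sqrt (b * h * x) ≤ Real.sqrt |m| := Real.sqrt_le_sqrt hm
  have h2 : (Real.sqrt |m|)⁻¹ ≤ (Real.sqrt (b * h * x))⁻¹ := by
    exact inv_anti₀ (Real.sqrt_pos.2 hbhx) h1
  refine h2.trans (le_of_eq ?_)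
  rw [Real.sqrt_mul (by positivity : (0 : ℝ) ≤ b * h) x, mul_inv, Real.sqrt_eq_rpow x, Real.rpow_neg hx.le]

/-- **The pre-side majorant integrates to `≤ 4/√b`** on `[0, δ]`, whatever `lo > 0`:  `∫₀^δ 8lo/(√b x + √lo)³ dx ≤ 4/√b`. -/
theorem intervalIntegral_pre_majorant_le {lo b δ : ℝ} (hlo : 0 < lo) (hb : 0 < b) (hδ : 0 ≤ δ) :
    ∫ x in (0 : ℝ)..δ, 8 * lo / (Real.sqrt b * x + Real.sqrt lo) ^ 3 ≤ 4 / Real.sqrt b := by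
  have hsb : 0 < Real.sqrt b := Real.sqrt_pos.2 hb
  have hsl : 0 < Real.sqrt lo := Real.sqrt_pos.2 hlo
  -- antiderivative `G(x) = −(4lo/√b)·((√b x + √lo)²)⁻¹`
  set G : ℝ → ℝ := fun x => -(4 * lo / Real.sqrt b) * ((Real.sqrt b * x + Real.sqrt lo) ^ 2)⁻¹ with hG
  have hq : ∀ x ∈ uIcc 0 δ, 0 < Real.sqrt b * x + Real.sqrt lo := fun x hx => by
    rw [uIcc_of_le hδ] at hx
    have : 0 ≤ Real.sqrt b * x := mul_nonneg hsb.le hx.1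
    linarith
  have hderiv : ∀ x ∈ uIcc 0 δ, HasDerivAt G (8 * lo / (Real.sqrt b * x + Real.sqrt lo) ^ 3) x := fun x hx => by
    have hqx := hq x hx
    have h1 : HasDerivAt (fun x : ℝ => Real.sqrt b * x + Real.sqrt lo) (Real.sqrt b) x := by
      simpa using ((hasDerivAt_id x).const_mul (Real.sqrt b)).add_const (Real.sqrt lo)
    have h2' := (hasDerivAt_pow 2 (Real.sqrt b * x + Real.sqrt lo)).comp x h1
    have h2 : HasDerivAt (fun y : ℝ => (Real.sqrt b * y + Real.sqrt lo) ^ 2)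
        (2 * (Real.sqrt b * x + Real.sqrt lo) * Real.sqrt b) x := by
      simpa [Function.comp_def] using h2'
    have h3 : HasDerivAt (fun y : ℝ => ((Real.sqrt b * y + Real.sqrt lo) ^ 2)⁻¹)
        (-(2 * (Real.sqrt b * x + Real.sqrt lo) * Real.sqrt b) / ((Real.sqrt b * x + Real.sqrt lo) ^ 2) ^ 2) x :=
      h2.inv (pow_ne_zero 2 hqx.ne')
    have h4 := h3.const_mul (-(4 * lo / Real.sqrt b))
    refine h4.congr_deriv ?_
    have hq0 : Real.sqrt b * x + Real.sqrt lo ≠ 0 := hqx.ne'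
    field_simp
    ring
  have hcont : ContinuousOn (fun x : ℝ => 8 * lo / (Real.sqrt b * x + Real.sqrt lo) ^ 3) (uIcc 0 δ) := by
    refine ContinuousOn.div continuousOn_const ((continuousOn_const.mul continuousOn_id).add continuousOn_const |>.pow 3) fun x hx => ?_
    exact pow_ne_zero 3 (hq x hx).ne'
  have hint : IntervalIntegrable (fun x : ℝ => 8 * lo / (Real.sqrt b * x + Real.sqrt lo) ^ 3) volume 0 δ :=
    hcont.intervalIntegrable
  rw [integral_eq_sub_of_hasDerivAt hderiv hint]
  -- `G δ − G 0 = (4lo/√b)(1/lo − 1/(√bδ+√lo)²) ≤ 4/√b`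
  have hG0 : G 0 = -(4 / Real.sqrt b) := by
    have h0 : (Real.sqrt b * 0 + Real.sqrt lo) ^ 2 = lo := by rw [mul_zero, zero_add, Real.sq_sqrt hlo.le]
    have h1 : G 0 = -(4 * lo / Real.sqrt b) * lo⁻¹ := by
      show -(4 * lo / Real.sqrt b) * ((Real.sqrt b * 0 + Real.sqrt lo) ^ 2)⁻¹ = _
      rw [h0]
    rw [h1]
    field_simp
  have hGδ : G δ ≤ 0 := by
    rw [hG]
    have : 0 < ((Real.sqrt b * δ + Real.sqrt lo) ^ 2)⁻¹ := by
      have h := hq δ (by rw [uIcc_of_le hδ]; exact right_mem_Icc.2 hδ); positivity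
    have : 0 < 4 * lo / Real.sqrt b := by positivity
    nlinarith
  rw [hG0]; linarith

/-- **The post-side majorant integrates to `2/√b`** on a half gap of length `h > 0`:  `∫₀^h (√(bh))⁻¹·x^{−1/2} dx = 2/√b`. -/
theorem intervalIntegral_post_majorant {b h : ℝ} (hb : 0 < b) (hh : 0 < h) :
    ∫ x in (0 : ℝ)..h, (Real.sqrt (b * h))⁻¹ * x ^ (-(1 / 2) : ℝ) = 2 / Real.sqrt b := by
  rw [intervalIntegral.integral_const_mul, integral_rpow (Or.inl (by norm_num : (-1 : ℝ) < -(1 / 2)))]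
  have h1 : (-(1 / 2) : ℝ) + 1 = 1 / 2 := by norm_num
  rw [h1, Real.zero_rpow (by norm_num : (1 / 2 : ℝ) ≠ 0), sub_zero, ← Real.sqrt_eq_rpow, Real.sqrt_mul hb.le]
  have hsh : 0 < Real.sqrt h := Real.sqrt_pos.2 hh
  have hsb : 0 < Real.sqrt b := Real.sqrt_pos.2 hb
  field_simp

/-! ## §2 The caustic pair layer -/

/-- **THE ϑ-LAYER AT A WEAKLY TRANSVERSAL PAIR / DOUBLE ZERO.**  `c₁ ≤ c₂`, `0 < δ`, `0 < b`, `0 < lo`, `A, P, B ≥ 0`; `F ≥ 0` on the window `[c₁ − δ, c₂ + δ]`; an offset `m`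
with `b·|ϑ − c₁|·|ϑ − c₂| ≤ |m ϑ|` on the window; OUTSIDE `[c₁, c₂]` the ONE-SIDED PRE-CAUSTIC law `F ϑ ≤ A·lo·(max |m ϑ| lo)⁻¹·(√(max |m ϑ| lo))⁻¹ + B`, INSIDE
`(c₁, c₂)` the LOG-FREE post-caustic law `F ϑ ≤ P·(√|m ϑ|)⁻¹ + B`.  THEN
`∫_{c₁−δ}^{c₂+δ} F ≤ (8A + 4P)/√b + B·(2δ + (c₂ − c₁))` — uniform in `lo` and in the gap `c₂ − c₁` (the double zero is `c₁ = c₂`).  No integrability hypothesis on `F`. -/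
theorem intervalIntegral_caustic_pair_le {F m : ℝ → ℝ} {c₁ c₂ δ b lo A P B : ℝ} (hc : c₁ ≤ c₂) (hδ : 0 < δ) (hb : 0 < b) (hlo : 0 < lo)
    (hA : 0 ≤ A) (hP : 0 ≤ P) (hB : 0 ≤ B)
    (hF0 : ∀ ϑ ∈ Icc (c₁ - δ) (c₂ + δ), 0 ≤ F ϑ)
    (hm : ∀ ϑ ∈ Icc (c₁ - δ) (c₂ + δ), b * |ϑ - c₁| * |ϑ - c₂| ≤ |m ϑ|)
    (hpre : ∀ ϑ ∈ Icc (c₁ - δ) (c₂ + δ), ϑ < c₁ ∨ c₂ < ϑ →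
      F ϑ ≤ A * (lo * ((max |m ϑ| lo)⁻¹ * (Real.sqrt (max |m ϑ| lo))⁻¹)) + B)
    (hpost : ∀ ϑ ∈ Ioo c₁ c₂, F ϑ ≤ P * (Real.sqrt |m ϑ|)⁻¹ + B) :
    ∫ ϑ in (c₁ - δ)..(c₂ + δ), F ϑ ≤ (8 * A + 4 * P) / Real.sqrt b + B * (2 * δ + (c₂ - c₁)) := by
  have hsb : 0 < Real.sqrt b := Real.sqrt_pos.2 hb
  have hRHS : 0 ≤ (8 * A + 4 * P) / Real.sqrt b + B * (2 * δ + (c₂ - c₁)) := by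
    have : 0 ≤ c₂ - c₁ := sub_nonneg.2 hc
    positivity
  by_cases hint : IntervalIntegrable F volume (c₁ - δ) (c₂ + δ)
  swap
  · rw [intervalIntegral.integral_undef hint]; exact hRHS
  set h : ℝ := (c₂ - c₁) / 2 with hh
  have hh0 : 0 ≤ h := by rw [hh]; linarith
  set mid : ℝ := c₁ + h with hmid
  have hmid' : mid = c₂ - h := by rw [hmid, hh]; ring
  -- integrability on the four pieces
  have hsub : ∀ p q : ℝ, c₁ - δ ≤ p → p ≤ q → q ≤ c₂ + δ → IntervalIntegrable F volume p q := fun p q hp hpq hq =>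
    hint.mono_set (by rw [uIcc_of_le hpq, uIcc_of_le (by linarith : c₁ - δ ≤ c₂ + δ)]; exact Icc_subset_Icc hp hq)
  have hi1 := hsub (c₁ - δ) c₁ le_rfl (by linarith) (by linarith)
  have hi2 := hsub c₁ mid (by linarith) (by rw [hmid]; linarith) (by rw [hmid']; linarith)
  have hi3 := hsub mid c₂ (by rw [hmid]; linarith) (by rw [hmid']; linarith) (by linarith)
  have hi4 := hsub c₂ (c₂ + δ) (by linarith) (by linarith) le_rfl
  rw [← integral_add_adjacent_intervals hi1 ((hi2.trans hi3).trans hi4), ← integral_add_adjacent_intervals hi2 (hi3.trans hi4),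
    ← integral_add_adjacent_intervals hi3 hi4]
  -- the pre-side majorant (distance form) and its integrability
  set gpre : ℝ → ℝ := fun x => A * (8 * lo / (Real.sqrt b * x + Real.sqrt lo) ^ 3) + B with hgpre
  have hq : ∀ x : ℝ, 0 ≤ x → 0 < Real.sqrt b * x + Real.sqrt lo := fun x hx => by
    have : 0 ≤ Real.sqrt b * x := mul_nonneg hsb.le hx
    have := Real.sqrt_pos.2 hlo; linarith
  have hgpre_cont : ContinuousOn gpre (Icc 0 δ) := by
    refine (ContinuousOn.const_mul (ContinuousOn.div continuousOn_const
      ((continuousOn_const.mul continuousOn_id).add continuousOn_const |>.pow 3) fun x hx => ?_) A).add continuousOn_const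
    exact pow_ne_zero 3 (hq x hx.1).ne'
  have hgpre_int : IntervalIntegrable gpre volume 0 δ := by
    rw [intervalIntegrable_iff_integrableOn_Icc_of_le hδ.le]
    exact hgpre_cont.integrableOn_compact isCompact_Icc
  have hgpre_val : ∫ x in (0 : ℝ)..δ, gpre x ≤ A * (4 / Real.sqrt b) + B * δ := by
    have hi : IntervalIntegrable (fun x : ℝ => 8 * lo / (Real.sqrt b * x + Real.sqrt lo) ^ 3) volume 0 δ := by
      rw [intervalIntegrable_iff_integrableOn_Icc_of_le hδ.le]
      refine ContinuousOn.integrableOn_compact isCompact_Icc ?_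
      refine ContinuousOn.div continuousOn_const ((continuousOn_const.mul continuousOn_id).add continuousOn_const |>.pow 3) fun x hx => ?_
      exact pow_ne_zero 3 (hq x hx.1).ne'
    simp only [hgpre]
    rw [intervalIntegral.integral_add (hi.const_mul A) intervalIntegrable_const, intervalIntegral.integral_const_mul,
      intervalIntegral.integral_const, sub_zero, smul_eq_mul]
    have h1 := intervalIntegral_pre_majorant_le hlo hb hδ.le
    nlinarith [h1, hA, mul_comm δ B]
  -- pointwise: outside `[c₁,c₂]`, at distance `x` from the nearer zero, `F ≤ gpre x`
  have hpre_pt : ∀ ϑ ∈ Icc (c₁ - δ) (c₂ + δ), ∀ x : ℝ, 0 ≤ x → (ϑ < c₁ ∨ c₂ < ϑ) → b * x ^ 2 ≤ |m ϑ| → F ϑ ≤ gpre x :=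
    fun ϑ hϑ x hx hside hbx => by
    have h1 := hpre ϑ hϑ hside
    have h2 := pre_majorant_le hlo hb hx hbx
    simp only [hgpre]
    have := mul_le_mul_of_nonneg_left h2 hA
    linarith
  -- piece 4: `[c₂, c₂ + δ]`, `x = ϑ − c₂`, `|m| ≥ b(ϑ−c₁)(ϑ−c₂) ≥ b x²`
  have hp4 : ∫ ϑ in c₂..(c₂ + δ), F ϑ ≤ A * (4 / Real.sqrt b) + B * δ := by
    have hmi : IntervalIntegrable (fun ϑ => gpre (ϑ - c₂)) volume c₂ (c₂ + δ) := by
      have h := (hgpre_int).comp_sub_right c₂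
      simp only [zero_add] at h
      rwa [add_comm] at h
    have hle : ∫ ϑ in c₂..(c₂ + δ), F ϑ ≤ ∫ ϑ in c₂..(c₂ + δ), gpre (ϑ - c₂) := by
      rw [intervalIntegral.integral_of_le (by linarith), intervalIntegral.integral_of_le (by linarith)]
      refine integral_mono_of_nonneg ?_ hmi.1 ?_
      · exact (ae_restrict_iff' measurableSet_Ioc).2 (Filter.Eventually.of_forall fun ϑ hϑ => hF0 ϑ ⟨by linarith [hϑ.1], hϑ.2⟩)
      · refine (ae_restrict_iff' measurableSet_Ioc).2 (Filter.Eventually.of_forall fun ϑ hϑ => ?_)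
        have hx : 0 < ϑ - c₂ := by linarith [hϑ.1]
        have hϑI : ϑ ∈ Icc (c₁ - δ) (c₂ + δ) := ⟨by linarith [hϑ.1], hϑ.2⟩
        refine hpre_pt ϑ hϑI (ϑ - c₂) hx.le (Or.inr hϑ.1) ?_
        have hmm := hm ϑ hϑI
        have h1 : ϑ - c₂ ≤ |ϑ - c₁| := by rw [abs_of_pos (by linarith [hϑ.1])]; linarith
        rw [abs_of_pos hx] at hmm
        calc b * (ϑ - c₂) ^ 2 = b * (ϑ - c₂) * (ϑ - c₂) := by ring
          _ ≤ b * |ϑ - c₁| * (ϑ - c₂) := by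
              exact mul_le_mul_of_nonneg_right (mul_le_mul_of_nonneg_left h1 hb.le) hx.le
          _ ≤ |m ϑ| := hmm
    refine hle.trans ?_
    rw [intervalIntegral.integral_comp_sub_right gpre c₂, sub_self, show c₂ + δ - c₂ = δ by ring]
    exact hgpre_val
  -- piece 1: `[c₁ − δ, c₁]`, `x = c₁ − ϑ`
  have hp1 : ∫ ϑ in (c₁ - δ)..c₁, F ϑ ≤ A * (4 / Real.sqrt b) + B * δ := by
    have hmi : IntervalIntegrable (fun ϑ => gpre (c₁ - ϑ)) volume (c₁ - δ) c₁ := by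
      have h := ((hgpre_int).comp_sub_left c₁).symm
      simpa using h
    have hle : ∫ ϑ in (c₁ - δ)..c₁, F ϑ ≤ ∫ ϑ in (c₁ - δ)..c₁, gpre (c₁ - ϑ) := by
      rw [intervalIntegral.integral_of_le (by linarith), intervalIntegral.integral_of_le (by linarith), integral_Ioc_eq_integral_Ioo,
        integral_Ioc_eq_integral_Ioo]
      refine integral_mono_of_nonneg ?_ (hmi.1.mono_set Ioo_subset_Ioc_self) ?_
      · exact (ae_restrict_iff' measurableSet_Ioo).2 (Filter.Eventually.of_forall fun ϑ hϑ => hF0 ϑ ⟨hϑ.1.le, by linarith [hϑ.2]⟩)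
      · refine (ae_restrict_iff' measurableSet_Ioo).2 (Filter.Eventually.of_forall fun ϑ hϑ => ?_)
        have hx : 0 < c₁ - ϑ := by linarith [hϑ.2]
        have hϑI : ϑ ∈ Icc (c₁ - δ) (c₂ + δ) := ⟨hϑ.1.le, by linarith [hϑ.2]⟩
        refine hpre_pt ϑ hϑI (c₁ - ϑ) hx.le (Or.inl hϑ.2) ?_
        have hmm := hm ϑ hϑI
        have h1 : c₁ - ϑ ≤ |ϑ - c₂| := by rw [abs_of_neg (by linarith [hϑ.2])]; linarith
        rw [abs_of_neg (by linarith [hϑ.2] : ϑ - c₁ < 0), neg_sub] at hmm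
        calc b * (c₁ - ϑ) ^ 2 = b * (c₁ - ϑ) * (c₁ - ϑ) := by ring
          _ ≤ b * (c₁ - ϑ) * |ϑ - c₂| := by
              exact mul_le_mul_of_nonneg_left h1 (by positivity)
          _ ≤ |m ϑ| := hmm
    refine hle.trans ?_
    rw [intervalIntegral.integral_comp_sub_left gpre c₁, sub_self, show c₁ - (c₁ - δ) = δ by ring]
    exact hgpre_val
  -- the two inner halves
  have hinner : (∫ ϑ in c₁..mid, F ϑ) + ∫ ϑ in mid..c₂, F ϑ ≤ P * (4 / Real.sqrt b) + B * (c₂ - c₁) := by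
    rcases eq_or_lt_of_le hh0 with hz | hpos
    · -- degenerate gap: both inner integrals vanish
      have hc0 : c₂ = c₁ := by
        have h2 : (c₂ - c₁) / 2 = 0 := by rw [← hh]; exact hz.symm
        linarith
      have hm0 : mid = c₁ := by rw [hmid, ← hz, add_zero]
      rw [hm0, hc0, intervalIntegral.integral_same, sub_self, mul_zero, add_zero, add_zero]
      positivity
    · -- the post-side majorant (distance form)
      set gpost : ℝ → ℝ := fun x => P * ((Real.sqrt (b * h))⁻¹ * x ^ (-(1 / 2) : ℝ)) + B with hgpost
      have hgpost_int : ∀ p q : ℝ, IntervalIntegrable gpost volume p q := fun p q =>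
        ((intervalIntegral.intervalIntegrable_rpow' (by norm_num)).const_mul _ |>.const_mul P).add intervalIntegrable_const
      have hgpost_val : ∫ x in (0 : ℝ)..h, gpost x = P * (2 / Real.sqrt b) + B * h := by
        simp only [hgpost]
        rw [intervalIntegral.integral_add (((intervalIntegral.intervalIntegrable_rpow' (by norm_num)).const_mul _).const_mul P)
          intervalIntegrable_const, intervalIntegral.integral_const_mul, intervalIntegral_post_majorant hb hpos, intervalIntegral.integral_const,
          sub_zero, smul_eq_mul, mul_comm h B]
      have hpost_pt : ∀ ϑ ∈ Ioo c₁ c₂, ∀ x : ℝ, 0 < x → b * h * x ≤ |m ϑ| → F ϑ ≤ gpost x := fun ϑ hϑ x hx hbx => by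
        have h1 := hpost ϑ hϑ
        have h2 := post_majorant_le hb hpos hx hbx
        simp only [hgpost]
        have := mul_le_mul_of_nonneg_left h2 hP
        linarith
      -- left inner half `[c₁, mid]`, `x = ϑ − c₁`, `c₂ − ϑ ≥ h`
      have hL : ∫ ϑ in c₁..mid, F ϑ ≤ P * (2 / Real.sqrt b) + B * h := by
        have hmi : IntervalIntegrable (fun ϑ => gpost (ϑ - c₁)) volume c₁ mid := by
          have h := (hgpost_int (c₁ - c₁) (mid - c₁)).comp_sub_right c₁
          simp only [sub_add_cancel, sub_self, zero_add] at h
          exact h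
        have hle : ∫ ϑ in c₁..mid, F ϑ ≤ ∫ ϑ in c₁..mid, gpost (ϑ - c₁) := by
          rw [intervalIntegral.integral_of_le (by rw [hmid]; linarith), intervalIntegral.integral_of_le (by rw [hmid]; linarith)]
          refine integral_mono_of_nonneg ?_ hmi.1 ?_
          · exact (ae_restrict_iff' measurableSet_Ioc).2 (Filter.Eventually.of_forall fun ϑ hϑ =>
              hF0 ϑ ⟨by linarith [hϑ.1], by rw [hmid'] at hϑ; linarith [hϑ.2]⟩)
          · refine (ae_restrict_iff' measurableSet_Ioc).2 (Filter.Eventually.of_forall fun ϑ hϑ => ?_)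
            have hx : 0 < ϑ - c₁ := by linarith [hϑ.1]
            have h2ϑ : h ≤ c₂ - ϑ := by rw [hmid'] at hϑ; linarith [hϑ.2]
            have hϑ2 : ϑ < c₂ := by linarith
            refine hpost_pt ϑ ⟨hϑ.1, hϑ2⟩ (ϑ - c₁) hx ?_
            have hmm := hm ϑ ⟨by linarith, by linarith⟩
            rw [abs_of_pos hx, abs_of_neg (by linarith : ϑ - c₂ < 0), neg_sub] at hmm
            calc b * h * (ϑ - c₁) = b * (ϑ - c₁) * h := by ring
              _ ≤ b * (ϑ - c₁) * (c₂ - ϑ) := mul_le_mul_of_nonneg_left h2ϑ (by positivity)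
              _ ≤ |m ϑ| := hmm
        refine hle.trans (le_of_eq ?_)
        rw [intervalIntegral.integral_comp_sub_right gpost c₁, sub_self, show mid - c₁ = h by rw [hmid]; ring, hgpost_val]
      -- right inner half `[mid, c₂]`, `x = c₂ − ϑ`, `ϑ − c₁ ≥ h`
      have hR : ∫ ϑ in mid..c₂, F ϑ ≤ P * (2 / Real.sqrt b) + B * h := by
        have hmi : IntervalIntegrable (fun ϑ => gpost (c₂ - ϑ)) volume mid c₂ := by
          have h := (hgpost_int (c₂ - mid) (c₂ - c₂)).comp_sub_left c₂
          simpa using h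
        have hle : ∫ ϑ in mid..c₂, F ϑ ≤ ∫ ϑ in mid..c₂, gpost (c₂ - ϑ) := by
          rw [intervalIntegral.integral_of_le (by rw [hmid']; linarith), intervalIntegral.integral_of_le (by rw [hmid']; linarith),
            integral_Ioc_eq_integral_Ioo, integral_Ioc_eq_integral_Ioo]
          refine integral_mono_of_nonneg ?_ (hmi.1.mono_set Ioo_subset_Ioc_self) ?_
          · exact (ae_restrict_iff' measurableSet_Ioo).2 (Filter.Eventually.of_forall fun ϑ hϑ =>
              hF0 ϑ ⟨by rw [hmid] at hϑ; linarith [hϑ.1], by linarith [hϑ.2]⟩)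
          · refine (ae_restrict_iff' measurableSet_Ioo).2 (Filter.Eventually.of_forall fun ϑ hϑ => ?_)
            have hx : 0 < c₂ - ϑ := by linarith [hϑ.2]
            have h1ϑ : h ≤ ϑ - c₁ := by rw [hmid] at hϑ; linarith [hϑ.1]
            have hϑ1 : c₁ < ϑ := by linarith
            refine hpost_pt ϑ ⟨hϑ1, hϑ.2⟩ (c₂ - ϑ) hx ?_
            have hmm := hm ϑ ⟨by linarith, by linarith⟩
            rw [abs_of_pos (by linarith : 0 < ϑ - c₁), abs_of_neg (by linarith : ϑ - c₂ < 0), neg_sub] at hmm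
            calc b * h * (c₂ - ϑ) ≤ b * (ϑ - c₁) * (c₂ - ϑ) :=
                  mul_le_mul_of_nonneg_right (mul_le_mul_of_nonneg_left h1ϑ hb.le) hx.le
              _ ≤ |m ϑ| := hmm
        refine hle.trans (le_of_eq ?_)
        rw [intervalIntegral.integral_comp_sub_left gpost c₂, sub_self, show c₂ - mid = h by rw [hmid']; ring, hgpost_val]
      have hh2 : B * (c₂ - c₁) = 2 * (B * h) := by rw [hh]; ring
      have hP2 : P * (4 / Real.sqrt b) = 2 * (P * (2 / Real.sqrt b)) := by ring
      rw [hh2, hP2]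
      linarith [hL, hR]
  -- assemble
  have htot : (8 * A + 4 * P) / Real.sqrt b + B * (2 * δ + (c₂ - c₁)) =
      (A * (4 / Real.sqrt b) + B * δ) + ((P * (4 / Real.sqrt b) + B * (c₂ - c₁)) + (A * (4 / Real.sqrt b) + B * δ)) := by
    field_simp; ring
  rw [htot]
  linarith [hp1, hp4, hinner]

end Summit.HubbardSuperconductivity.HubbardSuperconductivity.Theorems.C4a

end
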